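import Mathlib.Analysis.InnerProductSpace.PiL2
import Mathlib.Analysis.SpecialFunctions.Complex.Arg
import Mathlib.Data.Fin.Tuple.Sort
import Mathlib.Algebra.BigOperators.Fin
import Summits.Ventures.Crystal3D.Theorems.StickyWulffConstantNoReconstructionGainJointBoundTrig
import Literature.Algebra.EuclideanLattices.FccBccLattices
import HarnessLib

/-!
# Joint level/support bound — azimuths about an axis (line `joint-level-support-bound`)

HONEST FRAMING. Part of the venture `Summits/Ventures/Crystal3D` (cell `crystal3d-full`), helper
`--supports` the crux `NoReconstructionGain` (stmt-Ventures-19144, route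
`route-Ventures-StickyWulffConstant`), line `joint-level-support-bound`.  The azimuthal-gap machinery
shared by the two sphere-geometry stubs:

* `exists_azimuth` — RELATIVE AZIMUTHS: for a vector `p` with nonzero horizontal part there are
  `ρ, θ` with `ρ u ≥ 0`, `ρ u² = u₀² + u₁²`, `θ u ∈ [0, 2π)` and
  `ρ u ρ v cos (θ u - θ v) = u₀ v₀ + u₁ v₁`, `ρ u ρ p cos (θ u) = u₀ p₀ + u₁ p₁` (so `p` sits at
  azimuth `0`; built from `Complex.arg (⟨u₀, u₁⟩ · conj ⟨p₀, p₁⟩)`);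
* `arc_gt_deep_deep`, `arc_gt_deep_level`, `arc_gt_level_level` — the separation cores of
  `…JointBoundTrig` turned into angular statements: a nonnegative angle `x` with
  `ρ₁ ρ₂ cos x + z₁ z₂ ≤ 1/2` (the kissing separation of the two directions) exceeds the threshold `τ`
  whenever `cos τ` beats the relevant constant.

WHAT THIS IS NOT: any statement about packings; rung F-C1 not moved.
-/

noncomputable section

namespace Summit.Ventures.Crystal3D.Theorems

open Finset Real
open scoped InnerProductSpace ComplexConjugate

/-! Coordinates of `EuclideanSpace ℝ (Fin 3)`: `Literature.Algebra.EuclideanLattices.inner_fin_three`,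
`norm_sq_fin_three` (imported). -/

/-! ### Relative azimuths -/

/-- **Relative azimuths about the vertical axis.**  For `p` with nonzero horizontal part there are a
horizontal radius `ρ` and an azimuth `θ ∈ [0, 2π)` measured from `p` such that horizontal inner
products are `ρ u ρ v cos (θ u - θ v)`, and `ρ u ρ p cos (θ u) = u₀ p₀ + u₁ p₁`. -/
theorem exists_azimuth (p : EuclideanSpace ℝ (Fin 3)) (hp : 0 < p 0 ^ 2 + p 1 ^ 2) :
    ∃ ρ θ : EuclideanSpace ℝ (Fin 3) → ℝ,
      (∀ u, 0 ≤ ρ u ∧ ρ u ^ 2 = u 0 ^ 2 + u 1 ^ 2) ∧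
      (∀ u, 0 ≤ θ u ∧ θ u < 2 * π) ∧ θ p = 0 ∧
      (∀ u, ρ u * ρ p * Real.cos (θ u) = u 0 * p 0 + u 1 * p 1) ∧
      (∀ u v, ρ u * ρ v * Real.cos (θ u - θ v) = u 0 * v 0 + u 1 * v 1) := by
  classical
  -- horizontal parts as complex numbers, rotated so that `p` is real positive
  let W : EuclideanSpace ℝ (Fin 3) → ℂ := fun u => ⟨u 0, u 1⟩
  let a : EuclideanSpace ℝ (Fin 3) → ℂ := fun u => W u * conj (W p)
  let A : EuclideanSpace ℝ (Fin 3) → ℝ := fun u => Complex.arg (a u)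
  let θ : EuclideanSpace ℝ (Fin 3) → ℝ := fun u => if A u < 0 then A u + 2 * π else A u
  let ρ : EuclideanSpace ℝ (Fin 3) → ℝ := fun u => ‖W u‖
  have hρsq : ∀ u, ρ u ^ 2 = u 0 ^ 2 + u 1 ^ 2 := fun u => by
    show ‖W u‖ ^ 2 = _
    rw [Complex.sq_norm, Complex.normSq_mk]; ring
  have hρp : 0 < ρ p := by
    have h2 : 0 < ρ p ^ 2 := by rw [hρsq]; exact hp
    have h0 : 0 ≤ ρ p := norm_nonneg _
    nlinarith
  have hcosθ : ∀ u, Real.cos (θ u) = Real.cos (A u) := fun u => by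
    show Real.cos (if A u < 0 then A u + 2 * π else A u) = _
    split_ifs
    · exact Real.cos_add_two_pi _
    · rfl
  have hsinθ : ∀ u, Real.sin (θ u) = Real.sin (A u) := fun u => by
    show Real.sin (if A u < 0 then A u + 2 * π else A u) = _
    split_ifs
    · exact Real.sin_add_two_pi _
    · rfl
  have hnorm_a : ∀ u, ‖a u‖ = ρ u * ρ p := fun u => by
    show ‖W u * conj (W p)‖ = ‖W u‖ * ‖W p‖
    rw [norm_mul, Complex.norm_conj]
  have hre : ∀ u, (a u).re = u 0 * p 0 + u 1 * p 1 := fun u => by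
    show (W u * conj (W p)).re = _
    simp [W, Complex.mul_re, Complex.conj_re, Complex.conj_im]
  have him : ∀ u, (a u).im = u 1 * p 0 - u 0 * p 1 := fun u => by
    show (W u * conj (W p)).im = _
    simp [W, Complex.mul_im, Complex.conj_re, Complex.conj_im]; ring
  have hcosA : ∀ u, ρ u * ρ p * Real.cos (A u) = u 0 * p 0 + u 1 * p 1 := fun u => by
    rw [← hnorm_a, ← hre]; exact Complex.norm_mul_cos_arg _
  have hsinA : ∀ u, ρ u * ρ p * Real.sin (A u) = u 1 * p 0 - u 0 * p 1 := fun u => by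
    rw [← hnorm_a, ← him]; exact Complex.norm_mul_sin_arg _
  have hAp : A p = 0 := by
    show Complex.arg (W p * conj (W p)) = 0
    rw [Complex.mul_conj]
    exact Complex.arg_ofReal_of_nonneg (Complex.normSq_nonneg _)
  have hθp : θ p = 0 := by
    show (if A p < 0 then A p + 2 * π else A p) = 0
    rw [hAp]; simp
  refine ⟨ρ, θ, fun u => ⟨norm_nonneg _, hρsq u⟩, fun u => ?_, hθp, fun u => ?_, fun u v => ?_⟩
  · show 0 ≤ (if A u < 0 then A u + 2 * π else A u) ∧ (if A u < 0 then A u + 2 * π else A u) < 2 * π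
    have h1 := Complex.neg_pi_lt_arg (a u)
    have h2 := Complex.arg_le_pi (a u)
    change -π < A u at h1
    change A u ≤ π at h2
    split_ifs with h
    · constructor <;> linarith [Real.pi_pos]
    · push Not at h
      constructor <;> linarith [Real.pi_pos]
  · rw [hcosθ]; exact hcosA u
  · rw [Real.cos_sub, hcosθ, hcosθ, hsinθ, hsinθ]
    -- multiply by ρ p ^ 2 and cancel
    have hp2 : ρ p ^ 2 = p 0 ^ 2 + p 1 ^ 2 := hρsq p
    have key : (ρ u * ρ v * (Real.cos (A u) * Real.cos (A v) + Real.sin (A u) * Real.sin (A v)))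
        * ρ p ^ 2 = (u 0 * v 0 + u 1 * v 1) * ρ p ^ 2 := by
      have e : (ρ u * ρ v * (Real.cos (A u) * Real.cos (A v) + Real.sin (A u) * Real.sin (A v)))
          * ρ p ^ 2 = (ρ u * ρ p * Real.cos (A u)) * (ρ v * ρ p * Real.cos (A v)) +
            (ρ u * ρ p * Real.sin (A u)) * (ρ v * ρ p * Real.sin (A v)) := by ring
      rw [e, hcosA, hcosA, hsinA, hsinA, hp2]; ring
    have hp2pos : 0 < ρ p ^ 2 := by positivity
    exact mul_right_cancel₀ hp2pos.ne' key

/-! ### Arcs from separations -/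

/-- **Deep–deep arc.**  Two deep directions (heights `z₁ ≤ -a_lo ≤ -1/2`, `z₂ ≤ -1/2`, horizontal
radii `ρᵢ > 0`) separated by `60°` span an azimuthal angle `x > τ` as soon as `cos τ > c > 0` with
`1 - 3c² < a_lo (1 + 3c²)` (`x ≥ 0`, `τ ≤ π`). -/
theorem arc_gt_deep_deep (c τ alo z₁ z₂ ρ₁ ρ₂ x : ℝ) (hc : 0 < c) (hcτ : c < Real.cos τ)
    (hτ : τ ≤ π) (halo : 1 / 2 ≤ alo) (hcond : 1 - 3 * c ^ 2 < alo * (1 + 3 * c ^ 2))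
    (hz₁ : z₁ ≤ -alo) (hz₂ : z₂ ≤ -(1 / 2)) (hρ₁ : 0 < ρ₁) (hρ₂ : 0 < ρ₂)
    (h₁ : z₁ ^ 2 + ρ₁ ^ 2 = 1) (h₂ : z₂ ^ 2 + ρ₂ ^ 2 = 1) (hx : 0 ≤ x)
    (hsep : ρ₁ * ρ₂ * Real.cos x + z₁ * z₂ ≤ 1 / 2) : τ < x := by
  refine lt_of_cos_lt_cos_of_nonneg hx hτ ?_
  by_contra hle
  push Not at hle
  have hcx : c < Real.cos x := lt_of_lt_of_le hcτ hle
  have key := sep_deep_core c alo (-z₁) (-z₂) ρ₁ ρ₂ hc halo hcond (by linarith) (by linarith)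
    hρ₁ hρ₂ (by nlinarith) (by nlinarith)
  have : c * (ρ₁ * ρ₂) ≤ ρ₁ * ρ₂ * Real.cos x := by nlinarith [mul_pos hρ₁ hρ₂]
  nlinarith

/-- **Deep–level arc.**  A deep direction (height `z₁ ∈ [-a_hi, -1/2]`) and a `1/10`-level one
(`|z₂| ≤ 1/10`) separated by `60°` span an azimuthal angle `x > τ` as soon as `cos τ > c > 0` with
`(1/2 + a_hi/10)² < c² (99/100) (1 - a_hi²)`. -/
theorem arc_gt_deep_level (c τ ahi z₁ z₂ ρ₁ ρ₂ x : ℝ) (hc : 0 < c) (hcτ : c < Real.cos τ)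
    (hτ : τ ≤ π) (hcond : (1 / 2 + ahi / 10) ^ 2 < c ^ 2 * (99 / 100) * (1 - ahi ^ 2))
    (hz₁ : z₁ ≤ -(1 / 2)) (hz₁' : -ahi ≤ z₁) (hz₂ : |z₂| ≤ 1 / 10) (hρ₁ : 0 ≤ ρ₁) (hρ₂ : 0 ≤ ρ₂)
    (h₁ : z₁ ^ 2 + ρ₁ ^ 2 = 1) (h₂ : z₂ ^ 2 + ρ₂ ^ 2 = 1) (hx : 0 ≤ x)
    (hsep : ρ₁ * ρ₂ * Real.cos x + z₁ * z₂ ≤ 1 / 2) : τ < x := by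
  refine lt_of_cos_lt_cos_of_nonneg hx hτ ?_
  by_contra hle
  push Not at hle
  have hcx : c < Real.cos x := lt_of_lt_of_le hcτ hle
  have key := sep_level_core c ahi (-z₁) z₂ ρ₁ ρ₂ hc hcond (by linarith) (by linarith) hz₂ hρ₁ hρ₂
    (by nlinarith) h₂
  have : c * (ρ₁ * ρ₂) ≤ ρ₁ * ρ₂ * Real.cos x := by nlinarith [mul_nonneg hρ₁ hρ₂]
  nlinarith

/-- **Level–level arc.**  Two `1/10`-level directions separated by `60°` span an azimuthal angle
`x > τ` as soon as `cos τ > c ≥ 0.52`. -/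
theorem arc_gt_level_level (c τ z₁ z₂ ρ₁ ρ₂ x : ℝ) (hc : 52 / 100 ≤ c) (hcτ : c < Real.cos τ)
    (hτ : τ ≤ π) (hz₁ : |z₁| ≤ 1 / 10) (hz₂ : |z₂| ≤ 1 / 10) (hρ₁ : 0 ≤ ρ₁) (hρ₂ : 0 ≤ ρ₂)
    (h₁ : z₁ ^ 2 + ρ₁ ^ 2 = 1) (h₂ : z₂ ^ 2 + ρ₂ ^ 2 = 1) (hx : 0 ≤ x)
    (hsep : ρ₁ * ρ₂ * Real.cos x + z₁ * z₂ ≤ 1 / 2) : τ < x := by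
  refine lt_of_cos_lt_cos_of_nonneg hx hτ ?_
  by_contra hle
  push Not at hle
  have hcx : c < Real.cos x := lt_of_lt_of_le hcτ hle
  have key := sep_level_level_core c z₁ z₂ ρ₁ ρ₂ hc hz₁ hz₂ hρ₁ hρ₂ h₁ h₂
  have : c * (ρ₁ * ρ₂) ≤ ρ₁ * ρ₂ * Real.cos x := by nlinarith [mul_nonneg hρ₁ hρ₂]
  nlinarith

/-! ### Sorting by azimuth and the weighted cycle for a finite set -/

/-- A finite set of vectors can be enumerated in nondecreasing order of any real function `θ`. -/
theorem exists_sorted_equiv (T : Finset (EuclideanSpace ℝ (Fin 3)))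
    (θ : EuclideanSpace ℝ (Fin 3) → ℝ) :
    ∃ e : Fin T.card ≃ T, Monotone (fun i => θ (e i)) := by
  classical
  let e₀ : Fin T.card ≃ T := T.equivFin.symm
  let f : Fin T.card → ℝ := fun i => θ (e₀ i)
  refine ⟨(Tuple.sort f).trans e₀, ?_⟩
  have h := Tuple.monotone_sort f
  intro i j hij
  exact h hij

/-- **Weighted azimuthal cycle for a finite set.**  `p` is a distinguished point at azimuth `0`,
`T` a nonempty finite set not containing it, `θ` an azimuth with values in `[0, 2π)`, `w` a weight.
If for any two distinct points `u, v` of `insert p T` every nonnegative angle `x` with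
`cos x = cos (θ u - θ v)` exceeds `w u + w v`, then `2 w p + 2 Σ_{T} w < 2π`. -/
theorem weighted_cycle_finset (p : EuclideanSpace ℝ (Fin 3)) (T : Finset (EuclideanSpace ℝ (Fin 3)))
    (hT : T.Nonempty) (hpT : p ∉ T) (θ w : EuclideanSpace ℝ (Fin 3) → ℝ) (hθp : θ p = 0)
    (hθ : ∀ u, 0 ≤ θ u ∧ θ u < 2 * π)
    (hgap : ∀ u ∈ insert p T, ∀ v ∈ insert p T, u ≠ v → ∀ x : ℝ, 0 ≤ x →
      Real.cos x = Real.cos (θ u - θ v) → w u + w v < x) :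
    2 * w p + 2 * ∑ u ∈ T, w u < 2 * π := by
  classical
  set m := T.card with hm
  obtain ⟨e, hmono⟩ := exists_sorted_equiv T θ
  have hm1 : 1 ≤ m := by rw [hm]; exact Finset.card_pos.2 hT
  let tN : ℕ → ℝ := fun i => if h : i < m then θ (e ⟨i, h⟩ : EuclideanSpace ℝ (Fin 3)) else 0
  let wN : ℕ → ℝ := fun i => if h : i < m then w (e ⟨i, h⟩ : EuclideanSpace ℝ (Fin 3)) else 0
  have htN : ∀ i (h : i < m), tN i = θ (e ⟨i, h⟩ : EuclideanSpace ℝ (Fin 3)) := fun i h => dif_pos h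
  have hwN : ∀ i (h : i < m), wN i = w (e ⟨i, h⟩ : EuclideanSpace ℝ (Fin 3)) := fun i h => dif_pos h
  have hmemT : ∀ i (h : i < m), ((e ⟨i, h⟩ : T) : EuclideanSpace ℝ (Fin 3)) ∈ T :=
    fun i h => (e ⟨i, h⟩).2
  have hmem : ∀ i (h : i < m), ((e ⟨i, h⟩ : T) : EuclideanSpace ℝ (Fin 3)) ∈ insert p T :=
    fun i h => Finset.mem_insert_of_mem (hmemT i h)
  have hp : p ∈ insert p T := Finset.mem_insert_self _ _
  have hne_p : ∀ i (h : i < m), ((e ⟨i, h⟩ : T) : EuclideanSpace ℝ (Fin 3)) ≠ p :=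
    fun i h heq => hpT (heq ▸ hmemT i h)
  have hinj : ∀ i j (hi : i < m) (hj : j < m), i ≠ j →
      ((e ⟨i, hi⟩ : T) : EuclideanSpace ℝ (Fin 3)) ≠ ((e ⟨j, hj⟩ : T) : EuclideanSpace ℝ (Fin 3)) := by
    intro i j hi hj hij heq
    have : (⟨i, hi⟩ : Fin m) = ⟨j, hj⟩ := e.injective (Subtype.ext heq)
    exact hij (by simpa using this)
  have key := weighted_cycle (m - 1) tN wN (w p) ?_ ?_ ?_
  · -- translate the conclusion
    have hsum : ∑ i ∈ Finset.range (m - 1 + 1), wN i = ∑ u ∈ T, w u := by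
      rw [show m - 1 + 1 = m by omega, Finset.sum_range (fun i => wN i)]
      have h1 : ∑ i : Fin m, wN i = ∑ i : Fin m, w (e i : EuclideanSpace ℝ (Fin 3)) :=
        Finset.sum_congr rfl fun i _ => hwN i i.2
      rw [h1]
      have h2 : ∑ i : Fin m, w (e i : EuclideanSpace ℝ (Fin 3)) =
          ∑ u : T, w (u : EuclideanSpace ℝ (Fin 3)) :=
        e.sum_comp (fun u : T => w (u : EuclideanSpace ℝ (Fin 3)))
      rw [h2, Finset.sum_coe_sort T w]
    rw [hsum] at key
    exact key
  · -- first gap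
    have h0 : 0 < m := by omega
    rw [htN 0 h0, hwN 0 h0]
    have hx := (hθ (e ⟨0, h0⟩ : EuclideanSpace ℝ (Fin 3))).1
    have := hgap _ (hmem 0 h0) p hp (hne_p 0 h0) _ hx (by rw [hθp, sub_zero])
    linarith
  · -- consecutive gaps
    intro i hi
    have hi1 : i + 1 < m := by omega
    have hi0 : i < m := by omega
    rw [htN (i + 1) hi1, htN i hi0, hwN (i + 1) hi1, hwN i hi0]
    have hx : 0 ≤ θ (e ⟨i + 1, hi1⟩ : EuclideanSpace ℝ (Fin 3)) - θ (e ⟨i, hi0⟩ : EuclideanSpace ℝ (Fin 3)) := by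
      have := hmono (show (⟨i, hi0⟩ : Fin m) ≤ ⟨i + 1, hi1⟩ from by simp [Fin.le_def])
      simp only at this
      linarith
    have := hgap _ (hmem (i + 1) hi1) _ (hmem i hi0) (hinj (i + 1) i hi1 hi0 (by omega)) _ hx rfl
    linarith
  · -- closing gap
    have hl : m - 1 < m := by omega
    rw [htN (m - 1) hl, hwN (m - 1) hl]
    have hx : 0 ≤ 2 * π - θ (e ⟨m - 1, hl⟩ : EuclideanSpace ℝ (Fin 3)) := by
      have := (hθ (e ⟨m - 1, hl⟩ : EuclideanSpace ℝ (Fin 3))).2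
      linarith
    have := hgap _ (hmem (m - 1) hl) p hp (hne_p (m - 1) hl) _ hx
      (by rw [Real.cos_two_pi_sub, hθp, sub_zero])
    linarith

end Summit.Ventures.Crystal3D.Theorems

end
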